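import Mathlib.Algebra.Quaternion
import Mathlib.Data.Matrix.Basic
import Mathlib.RingTheory.DedekindDomain.AdicValuation
import Mathlib.NumberTheory.NumberField.Basic
import Mathlib.NumberTheory.NumberField.Completion.InfinitePlace
import HarnessLib

/-!
# The Hilbert symbol and Hilbert's reciprocity law

Topic `NumberTheory/QuadraticForms`; namespace `Literature`.

* `hilbertSymbol F a b : ℤ` — the **Hilbert symbol** `(a, b)_F ∈ {1, -1}` of two elements of a
  field `F`: `1` if `a x² + b y² = 1` is soluble in `F`, `-1` otherwise (O'Meara, *Introduction to
  quadratic forms*, §63B, verbatim; there it is used for `a b ≠ 0` over a local field or a complete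
  archimedean field, but the definition makes sense over any field). Basic API: the value is `±1`
  (`hilbertSymbol_eq_one_or_eq_neg_one`), characterisations of the values, symmetry, `(1, b) = 1`,
  `(a, b) = 1` for `a` a non-zero square.
* Named facts (published theorems not yet proved here, `def … : Prop` with citation):
  - `QuaternionAlgebra.nonempty_algEquiv_matrix_iff_hilbertSymbol_eq_one F a b`: for `a b ≠ 0` in
    a field of characteristic `≠ 2`, the quaternion algebra `ℍ[F,a,b]` (`i² = a`, `j² = b`,
    `ij = -ji`) is isomorphic to `M₂(F)` iff `(a, b)_F = 1` (O'Meara 57:9, (1) ⇔ (5));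
  - `hilbertReciprocity K a b`: **Hilbert's reciprocity law** for a number field `K` and
    `a b ∈ Kˣ`: `(a, b)_v = 1` for almost all places `v` and `∏_v (a, b)_v = 1` over all places,
    finite and infinite (O'Meara 71:18; Vignéras, LNM 800, III Cor. 3.3), stated — the symbol
    being `±1`-valued — as: the set of places with `(a, b)_v = -1` is finite of even cardinality.

These are the two inputs of the classical proof (in characteristic `≠ 2`) that a quaternion
algebra over a number field is ramified at an even number of places (Vignéras III Thm. 3.1); see
`Literature/NumberTheory/Automorphic/QuaternionRamificationParity.lean`.

## Mathlib searches

Mathlib has `legendreSym`, `jacobiSym`, `quadraticChar`, quadratic reciprocity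
(`legendreSym.quadratic_reciprocity`), `ℍ[R,a,b]` (`Mathlib/Algebra/Quaternion.lean`), completions
`HeightOneSpectrum.adicCompletion`, `NumberField.InfinitePlace.Completion`; it has no Hilbert
symbol, no local class field theory and no Hilbert reciprocity (`rg -i "hilbert symbol"`,
`rg hilbertSym` in Mathlib: no hits). The `ℤ`-valued convention follows `legendreSym`.

## References

* O. T. O'Meara, *Introduction to quadratic forms*, Grundlehren 117, Springer (1963), §57
  (Prop. 57:9), §63B (definition of the Hilbert symbol), §71 (Thm. 71:18).
* M.-F. Vignéras, *Arithmétique des algèbres de quaternions*, LNM 800 (1980), Ch. II §1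
  (symbole de Hilbert, Cor. 1.2), Ch. III §3 (Cor. 3.3).
-/

noncomputable section

open scoped Quaternion
open NumberField IsDedekindDomain

namespace Literature.NumberTheory.QuadraticForms

section HilbertSymbol

variable (F : Type*) [Field F]

open Classical in
/-- The **Hilbert symbol** `(a, b)_F ∈ {1, -1}` of two elements `a b` of a field `F`: `+1` if
`a x² + b y² = 1` has a solution `x y ∈ F`, and `-1` otherwise (O'Meara §63B, p. 164 of the 1963
edition, verbatim). O'Meara takes `a b ≠ 0` and `F` a local field or `ℝ`, `ℂ`; the definition
makes sense for any field and any `a b` (for `a = 0` or `b = 0` it is a harmless junk value, e.g.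
`(0, b)_F = 1` iff `b` is a non-zero square). For `a b ≠ 0` and `char F ≠ 2` it equals `1` iff
`a x² + b y² = z²` has a non-trivial zero (Vignéras II §1), iff `a` is a norm from `F(√b)`
(O'Meara 63:10), iff `ℍ[F,a,b] ≅ M₂(F)` (O'Meara 57:9). `ℤ`-valued like Mathlib's `legendreSym`.
[cite: Omeara1963, §63B (definition of the Hilbert symbol)] -/
def hilbertSymbol (a b : F) : ℤ :=
  if ∃ x y : F, a * x ^ 2 + b * y ^ 2 = 1 then 1 else -1

variable {F}

/-- `(a, b)_F = 1` iff `a x² + b y² = 1` is soluble in `F` (unfolding the definition). [folklore] -/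
theorem hilbertSymbol_eq_one_iff (a b : F) :
    hilbertSymbol F a b = 1 ↔ ∃ x y : F, a * x ^ 2 + b * y ^ 2 = 1 := by
  unfold hilbertSymbol
  split_ifs with h
  · simp [h]
  · simp [h]

/-- `(a, b)_F = -1` iff `a x² + b y² = 1` is insoluble in `F` (unfolding the definition). [folklore] -/
theorem hilbertSymbol_eq_neg_one_iff (a b : F) :
    hilbertSymbol F a b = -1 ↔ ¬ ∃ x y : F, a * x ^ 2 + b * y ^ 2 = 1 := by
  unfold hilbertSymbol
  split_ifs with h
  · simp [h]
  · simp [h]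

/-- The Hilbert symbol takes only the values `1` and `-1`. [folklore] -/
theorem hilbertSymbol_eq_one_or_eq_neg_one (a b : F) :
    hilbertSymbol F a b = 1 ∨ hilbertSymbol F a b = -1 := by
  unfold hilbertSymbol
  split_ifs <;> simp

/-- `(a, b)_F ≠ 1 ↔ (a, b)_F = -1`. [folklore] -/
theorem hilbertSymbol_ne_one_iff (a b : F) :
    hilbertSymbol F a b ≠ 1 ↔ hilbertSymbol F a b = -1 := by
  rcases hilbertSymbol_eq_one_or_eq_neg_one a b with h | h <;> simp [h]

/-- `(a, b)_F ≠ -1 ↔ (a, b)_F = 1`. [folklore] -/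
theorem hilbertSymbol_ne_neg_one_iff (a b : F) :
    hilbertSymbol F a b ≠ -1 ↔ hilbertSymbol F a b = 1 := by
  rcases hilbertSymbol_eq_one_or_eq_neg_one a b with h | h <;> simp [h]

/-- The Hilbert symbol is symmetric: `(a, b)_F = (b, a)_F` (O'Meara §63B). [folklore] -/
theorem hilbertSymbol_comm (a b : F) : hilbertSymbol F a b = hilbertSymbol F b a := by
  have h : (∃ x y : F, a * x ^ 2 + b * y ^ 2 = 1) ↔ ∃ x y : F, b * x ^ 2 + a * y ^ 2 = 1 := by
    constructor <;> rintro ⟨x, y, hxy⟩ <;> exact ⟨y, x, by linear_combination hxy⟩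
  by_cases hab : ∃ x y : F, a * x ^ 2 + b * y ^ 2 = 1
  · rw [(hilbertSymbol_eq_one_iff a b).2 hab, (hilbertSymbol_eq_one_iff b a).2 (h.1 hab)]
  · rw [(hilbertSymbol_eq_neg_one_iff a b).2 hab,
      (hilbertSymbol_eq_neg_one_iff b a).2 fun h' ↦ hab (h.2 h')]

/-- `(1, b)_F = 1` (take `x = 1`, `y = 0`). [folklore] -/
@[simp]
theorem hilbertSymbol_one_left (b : F) : hilbertSymbol F 1 b = 1 :=
  (hilbertSymbol_eq_one_iff 1 b).2 ⟨1, 0, by ring⟩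

/-- `(a, 1)_F = 1`. [folklore] -/
@[simp]
theorem hilbertSymbol_one_right (a : F) : hilbertSymbol F a 1 = 1 := by
  rw [hilbertSymbol_comm, hilbertSymbol_one_left]

/-- `(c², b)_F = 1` for `c ≠ 0` (take `x = c⁻¹`, `y = 0`); O'Meara §63B ("the first two of these
formulas are trivial for the Hilbert symbol"). [folklore] -/
theorem hilbertSymbol_eq_one_of_isSquare {a : F} (ha : IsSquare a) (ha0 : a ≠ 0) (b : F) :
    hilbertSymbol F a b = 1 := by
  obtain ⟨c, rfl⟩ := ha
  have hc : c ≠ 0 := fun h ↦ ha0 (by simp [h])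
  refine (hilbertSymbol_eq_one_iff _ b).2 ⟨c⁻¹, 0, ?_⟩
  rw [zero_pow two_ne_zero, mul_zero, add_zero, inv_pow, sq, mul_inv_cancel₀ (mul_ne_zero hc hc)]

end HilbertSymbol

/-! ### Named facts: the local splitting criterion and Hilbert reciprocity -/

/-- **Splitting criterion for `ℍ[F,a,b]`** (O'Meara, Prop. 57:9, (1) ⇔ (5)): for non-zero `a b`
in a field `F` of characteristic `≠ 2`, the quaternion algebra `ℍ[F,a,b]` (basis `1, i, j, k`,
`i² = a`, `j² = b`, `ij = -ji = k`; O'Meara's `(a, b / F)`) is isomorphic to the matrix algebra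
`M₂(F)` (O'Meara's `(1, -1 / F) ≅ M₂(F)`, §57A) if and only if the binary form `⟨a⟩ ⊥ ⟨b⟩`
represents `1`, i.e. iff the Hilbert symbol `(a, b)_F` is `1` (§63B). Also Vignéras, LNM 800,
Ch. I Cor. 2.4 with Ch. II §1 (Cor. 1.2). O'Meara's Chapter V carries the blanket assumption
`char F ≠ 2`, kept here as `[NeZero (2 : F)]`. [cite: Omeara1963, §57 Prop. 57:9] -/
def QuaternionAlgebra.nonempty_algEquiv_matrix_iff_hilbertSymbol_eq_one
    (F : Type*) [Field F] (a b : F) : Prop :=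
  ∀ [NeZero (2 : F)], a ≠ 0 → b ≠ 0 →
    (Nonempty (ℍ[F,a,b] ≃ₐ[F] Matrix (Fin 2) (Fin 2) F) ↔ hilbertSymbol F a b = 1)

/-- **Hilbert's reciprocity law** (O'Meara, Thm. 71:18; Vignéras, LNM 800, Ch. III Cor. 3.3):
let `a b` be non-zero elements of an algebraic number field `K`; then the Hilbert symbol
`(a, b)_v`, computed in the completion `K_v`, equals `1` for almost all places `v` of `K`, and
`∏_v (a, b)_v = 1`, the product taken over *all* places (finite places
`v : HeightOneSpectrum (𝓞 K)` with `K_v = v.adicCompletion K`, and infinite places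
`w : InfinitePlace K` with `K_w = w.Completion`). Because the symbol is `±1`-valued
(`hilbertSymbol_eq_one_or_eq_neg_one`) and there are finitely many infinite places, this is
*equivalent* to: the set of finite places with `(a, b)_v = -1` is finite, and the total number of
places (finite and infinite) with symbol `-1` is even — the form stated here, Mathlib having no
single type of all places of `K`. `K : Type` (universe `0`) as in the adelic files that use it.
[cite: Omeara1963, §71 Thm. 71:18] -/
def hilbertReciprocity (K : Type) [Field K] [NumberField K] (a b : K) : Prop :=
  a ≠ 0 → b ≠ 0 →
    {v : HeightOneSpectrum (𝓞 K) |
        hilbertSymbol (v.adicCompletion K) (algebraMap K _ a) (algebraMap K _ b) = -1}.Finite ∧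
    Even ({v : HeightOneSpectrum (𝓞 K) |
            hilbertSymbol (v.adicCompletion K) (algebraMap K _ a) (algebraMap K _ b) = -1}.ncard +
          {w : InfinitePlace K |
            hilbertSymbol w.Completion (algebraMap K _ a) (algebraMap K _ b) = -1}.ncard)

end Literature.NumberTheory.QuadraticForms
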